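import Mathlib
import HarnessLib
import Summits.NavierStokesRegularity.NavierStokesRegularity.Theorems.PoloidalWindowDoorPoloidalWindowRigidityZShockSlopeLevelCurves
import Summits.NavierStokesRegularity.NavierStokesRegularity.Theorems.PoloidalWindowDoorPoloidalWindowRigidityZShockAutonomyGlobal

/-!
# Crux K2 `PoloidalWindowRigidity` (stmt-NavierStokesRegularity-19708), line `z_shock` — L0(b), LOCAL FORM: PARALLEL GRADIENTS
# (RANK ONE) ⇒ THE SLOPE IS LOCALLY A FUNCTION OF `w`

`--supports stmt-NavierStokesRegularity-19708 --as helper` (leafhand-ns-poloidalwindowdoor-2 g0, 2026-08-31).  Class-free calculus,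
Mathlib only (+ the companion `…ZShockSlopeLevelCurves`).  **No stub and no summit is closed by this file; Navier–Stokes regularity is
NOT proved here.**

The deciding stub `stub_zShockThickAut` of `Lines/z_shock.lean` carries a LOCAL autonomy clause at one window point `z₀`
(`∂_z v_b = g(t, v₂)·∂_b v₂` on a sub-window).  L0(a) (tree, `…ZShockAutonomyGlobal`) globalises it along the analytic slice to
«all `2 × 2` minors of `(D_b, ∇v₂)` vanish everywhere», `D_b = ∂_b v₂·∇(∂_z v_b) − ∂_z v_b·∇(∂_b v₂)`.  L0(b) of the card
(`Lines/z_shock.md` §«First lemma of R3») turns vanishing minors back into a slope FUNCTION.  This file is its LOCAL form — the classical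
rank-one functional-dependence lemma, for real functions on a complete real normed space `E`:

* `exists_shearEquiv` — for functionals `A, ℓ` and a vector `e` with `A e ≠ 0`, `ℓ e = 1`, the shear `h ↦ h + (A h − ℓ h)·e` is a
  continuous linear automorphism of `E` (explicit inverse);
* `exists_comp_eq_of_fderiv_eq_smul` — **functional dependence**: `w` is `C¹` at `y`, `Dw(y) e ≠ 0`, `Λ` is differentiable near `y`
  and `DΛ(x) = c(x)·Dw(x)` near `y` ⇒ `Λ = g ∘ w` on a neighbourhood of `y` for SOME `g : ℝ → ℝ`.  Proof: the map
  `Φ(x) = x + (w x − ℓ x)·e`, `ℓ = (Dw(y) e)⁻¹·Dw(y)`, has `ℓ ∘ Φ = w` and derivative the shear above, so it is a local `C¹`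
  diffeomorphism (inverse function theorem, `ContDiffAt.toOpenPartialHomeomorph`); along its inverse `ψ`, `Dw(ψ q)[Dψ(q) d] = ℓ d`, so
  `Λ ∘ ψ` has zero derivative along `ker ℓ` and is constant on the slices `{ℓ = s}` of a small ball (mean value theorem); put
  `g(s) = Λ(ψ(Φ y + (s − w y)·e))`;
* `exists_comp_eq_of_minors_eq_zero` — the same with the hypothesis in the minors form of L0(a)/`…ZShockSlopeLevelCurves`;
* `exists_slope_function_near` — the quotient form used by the line: `N, D, w` differentiable near `y`, `w` `C¹` at `y`,
  `D = Dw(·) e` near `y`, `D y ≠ 0`, and the minors of `(D·∇N − N·∇D, ∇w)` vanish near `y` ⇒ `N = g(w)·D` near `y`;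
* `exists_slope_function_near_of_analytic` — for a real-analytic `f : ℝ³ → ℝ³` and `b : Fin 3`: if the minors of
  `(∂_b f₂·∇(∂_z f_b) − ∂_z f_b·∇(∂_b f₂), ∇f₂)` vanish everywhere (the conclusion of L0(a)
  `…ZShockAutonomyGlobal.minors_eq_zero_of_local_slope_function`), then near EVERY point `x` with `∂_b f₂(x) ≠ 0` the vertical shear
  is a slope function of the height component: `∂_z f_b = g_x(f₂)·∂_b f₂` on an open `U ∋ x`.

So L0(a) + this file: the local autonomy clause at ONE window point propagates to a local autonomy clause at EVERY slice point where
`∂_b v₂ ≠ 0` (with a point-dependent `g_x`; patching the `g_x` along level sets of `v₂` — L0(c) — is not addressed here).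

presearch: rank-one functional dependence / «Jacobian vanishes ⇒ function of» — not in Mathlib (only the inverse/implicit function
theorems it is built from here); tree: only the companions `…ZShockSlopeFunctionParallel` (converse direction), `…ZShockSlopeLevelCurves`
(constancy along given level curves). [folklore]
-/

noncomputable section

namespace Summit.NavierStokesRegularity.NavierStokesRegularity.Theorems.PoloidalWindowDoorPoloidalWindowRigidityZShockSlopeFunctionLocal

-- the problem directory repeats the summit name (`NavierStokesRegularity/NavierStokesRegularity`)
set_option linter.dupNamespace false

open Set Filter Topology Function Metric
open Summit.NavierStokesRegularity.NavierStokesRegularity.Theorems.PoloidalWindowDoorPoloidalWindowRigidityZShockSlopeLevelCurves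
open Summit.NavierStokesRegularity.NavierStokesRegularity.Theorems.PoloidalWindowDoorPoloidalWindowRigidityZShockAutonomyGlobal
open Summit.NavierStokesRegularity.NavierStokesRegularity.Theorems.PoloidalWindowDoorPoloidalWindowRigidityConstantShearMeans
  (fderiv_coord_apply)
open Summit.NavierStokesRegularity.NavierStokesRegularity.Theorems.PoloidalWindowDoorPoloidalWindowRigidityHorizontalSourceGauge
  (analyticOnNhd_fderiv_apply_coord)

variable {E : Type*} [NormedAddCommGroup E] [NormedSpace ℝ E]

/-- The shear map `h ↦ h + (A h − ℓ h)·e` as a continuous linear map, evaluated. [folklore] -/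
theorem shear_apply (A ℓ : E →L[ℝ] ℝ) (e h : E) :
    (ContinuousLinearMap.id ℝ E + (A - ℓ).smulRight e) h = h + (A h - ℓ h) • e := by
  simp [ContinuousLinearMap.smulRight_apply]

/-- The candidate inverse `k ↦ k − (A e)⁻¹(A k − ℓ k)·e` of the shear map, evaluated. [folklore] -/
theorem shearInv_apply (A ℓ : E →L[ℝ] ℝ) (e k : E) :
    (ContinuousLinearMap.id ℝ E - ((A e)⁻¹ • (A - ℓ)).smulRight e) k = k - ((A e)⁻¹ * (A k - ℓ k)) • e := by
  simp [ContinuousLinearMap.smulRight_apply]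

/-- **The shear automorphism.**  For continuous functionals `A, ℓ` on `E` and `e ∈ E` with `A e ≠ 0`, `ℓ e = 1`, the map
`h ↦ h + (A h − ℓ h)·e` is a continuous linear automorphism of `E`, with inverse `k ↦ k − (A e)⁻¹(A k − ℓ k)·e`. [folklore] -/
theorem exists_shearEquiv (A ℓ : E →L[ℝ] ℝ) (e : E) (hA : A e ≠ 0) (hℓ : ℓ e = 1) :
    ∃ L : E ≃L[ℝ] E, (L : E →L[ℝ] E) = ContinuousLinearMap.id ℝ E + (A - ℓ).smulRight e := by
  refine ⟨ContinuousLinearEquiv.equivOfInverse (ContinuousLinearMap.id ℝ E + (A - ℓ).smulRight e)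
    (ContinuousLinearMap.id ℝ E - ((A e)⁻¹ • (A - ℓ)).smulRight e) ?_ ?_, rfl⟩
  · intro h
    rw [shear_apply, shearInv_apply]
    have hc : (A e)⁻¹ * (A (h + (A h - ℓ h) • e) - ℓ (h + (A h - ℓ h) • e)) = A h - ℓ h := by
      simp only [map_add, map_smul, smul_eq_mul, hℓ]
      field_simp
      ring
    rw [hc]
    exact add_sub_cancel_right _ _
  · intro k
    rw [shearInv_apply, shear_apply]
    have hc : A (k - ((A e)⁻¹ * (A k - ℓ k)) • e) - ℓ (k - ((A e)⁻¹ * (A k - ℓ k)) • e) =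
        (A e)⁻¹ * (A k - ℓ k) := by
      simp only [map_sub, map_smul, smul_eq_mul, hℓ]
      field_simp
      ring
    rw [hc]
    exact sub_add_cancel _ _

/-- **Rank-one functional dependence (local).**  Let `E` be a complete real normed space, `w : E → ℝ` of class `C¹` at `y` with
`Dw(y) e ≠ 0`, and `Λ : E → ℝ` differentiable near `y` with `DΛ(x) = c(x)·Dw(x)` for all `x` near `y`.  Then there is `g : ℝ → ℝ`
with `Λ x = g (w x)` for all `x` near `y`. [folklore] -/
theorem exists_comp_eq_of_fderiv_eq_smul [CompleteSpace E] {Λ w : E → ℝ} {y e : E}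
    (hw : ContDiffAt ℝ 1 w y) (he : fderiv ℝ w y e ≠ 0)
    (hΛ : ∀ᶠ x in 𝓝 y, DifferentiableAt ℝ Λ x)
    (hpar : ∀ᶠ x in 𝓝 y, ∃ c : ℝ, fderiv ℝ Λ x = c • fderiv ℝ w x) :
    ∃ g : ℝ → ℝ, ∀ᶠ x in 𝓝 y, Λ x = g (w x) := by
  -- `w` is `C¹` near `y` and `Dw(x) e ≠ 0` near `y`
  have hw1 : ∀ᶠ x in 𝓝 y, ContDiffAt ℝ 1 w x := hw.eventually (by simp)
  have hne : ∀ᶠ x in 𝓝 y, fderiv ℝ w x e ≠ 0 := by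
    have hc : ContinuousAt (fun x => fderiv ℝ w x e) y :=
      ((ContinuousLinearMap.apply ℝ ℝ e).continuous.continuousAt).comp (hw.continuousAt_fderiv one_ne_zero)
    exact hc.eventually_ne he
  -- the functional `ℓ` with `ℓ e = 1` and the straightening map `Φ`
  set a : ℝ := fderiv ℝ w y e with ha
  set ℓ : E →L[ℝ] ℝ := a⁻¹ • fderiv ℝ w y with hℓdef
  have hℓ : ℓ e = 1 := by
    simp only [hℓdef, _root_.smul_apply, smul_eq_mul, ← ha]
    exact inv_mul_cancel₀ he
  set Φ : E → E := fun x => x + (w x - ℓ x) • e with hΦdef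
  have hΦw : ∀ x, ℓ (Φ x) = w x := by
    intro x
    simp only [hΦdef, map_add, map_smul, smul_eq_mul, hℓ]
    ring
  have hΦd : ∀ x, DifferentiableAt ℝ w x →
      HasFDerivAt Φ (ContinuousLinearMap.id ℝ E + (fderiv ℝ w x - ℓ).smulRight e) x := by
    intro x hx
    exact (hasFDerivAt_id x).add ((hx.hasFDerivAt.sub ℓ.hasFDerivAt).smul_const e)
  obtain ⟨L, hL⟩ := exists_shearEquiv (fderiv ℝ w y) ℓ e he hℓ
  have hΦy : HasFDerivAt Φ (L : E →L[ℝ] E) y := by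
    rw [hL]; exact hΦd y (hw.differentiableAt one_ne_zero)
  have hΦc : ContDiffAt ℝ 1 Φ y :=
    contDiffAt_id.add ((hw.sub ℓ.contDiff.contDiffAt).smul contDiffAt_const)
  -- the local inverse `ψ = φ.symm`
  set φ := hΦc.toOpenPartialHomeomorph Φ hΦy one_ne_zero with hφdef
  have hφ : (φ : E → E) = Φ := hΦc.toOpenPartialHomeomorph_coe hΦy one_ne_zero
  have hyS : y ∈ φ.source := hΦc.mem_toOpenPartialHomeomorph_source hΦy one_ne_zero
  -- the good neighbourhood `V` of `y` and the open set `T' = target ∩ ψ⁻¹ V ∋ Φ y`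
  obtain ⟨V, hVsub, hVopen, hyV⟩ := _root_.mem_nhds_iff.1 (hw1.and (hne.and (hΛ.and hpar)))
  set T' : Set E := φ.target ∩ φ.symm ⁻¹' V with hT'def
  have hT'open : IsOpen T' := φ.isOpen_inter_preimage_symm hVopen
  have hyΦ : φ.symm (Φ y) = y := by rw [← hφ]; exact φ.left_inv hyS
  have hq₀T' : Φ y ∈ T' := by
    refine ⟨?_, ?_⟩
    · rw [← hφ]; exact φ.map_source hyS
    · show φ.symm (Φ y) ∈ V
      rw [hyΦ]; exact hyV
  obtain ⟨r, hr, hball⟩ := Metric.isOpen_iff.1 hT'open (Φ y) hq₀T'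
  -- derivative of `ψ` on `T'`, and `Dw(ψ q)[Dψ(q) d] = ℓ d`
  have hderivψ : ∀ q ∈ T', ∃ M : E →L[ℝ] E, HasFDerivAt φ.symm M q ∧
      ∀ d, fderiv ℝ w (φ.symm q) (M d) = ℓ d := by
    intro q hq
    have hx := hVsub hq.2
    obtain ⟨Lx, hLx⟩ := exists_shearEquiv (fderiv ℝ w (φ.symm q)) ℓ e hx.2.1 hℓ
    have hΦx : HasFDerivAt φ (Lx : E →L[ℝ] E) (φ.symm q) := by
      rw [hφ, hLx]; exact hΦd _ (hx.1.differentiableAt one_ne_zero)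
    refine ⟨(Lx.symm : E →L[ℝ] E), φ.hasFDerivAt_symm hq.1 hΦx, fun d => ?_⟩
    have key : ∀ h, ℓ (Lx h) = fderiv ℝ w (φ.symm q) h := by
      intro h
      rw [show Lx h = (Lx : E →L[ℝ] E) h from rfl, hLx]
      rw [shear_apply, map_add, map_smul, hℓ, smul_eq_mul, mul_one]
      ring
    have h := key (Lx.symm d)
    rw [ContinuousLinearEquiv.apply_symm_apply] at h
    exact h.symm
  -- `Λ ∘ ψ` is constant on the slices `{ℓ = s}` of the ball
  have hconst : ∀ q q', q ∈ ball (Φ y) r → q' ∈ ball (Φ y) r → ℓ q = ℓ q' →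
      Λ (φ.symm q') = Λ (φ.symm q) := by
    intro q q' hq hq' hℓqq'
    set d : E := q' - q with hd_def
    have hd : ℓ d = 0 := by simp [hd_def, hℓqq']
    have hseg : ∀ t ∈ Icc (0 : ℝ) 1, q + t • d ∈ ball (Φ y) r := by
      intro t ht
      have h := (convex_ball (Φ y) r).add_smul_sub_mem hq hq' ht
      simpa [hd_def] using h
    have hG : ∀ t ∈ Icc (0 : ℝ) 1, HasDerivAt (fun s : ℝ => Λ (φ.symm (q + s • d))) 0 t := by
      intro t ht
      have hqT' : q + t • d ∈ T' := hball (hseg t ht)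
      obtain ⟨M, hM, hMw⟩ := hderivψ _ hqT'
      have hx := hVsub hqT'.2
      obtain ⟨c, hc⟩ := hx.2.2.2
      have h1 : HasDerivAt (fun s : ℝ => q + s • d) d t := by
        simpa using ((hasDerivAt_id t).smul_const d).const_add q
      have h2 : HasDerivAt (fun s : ℝ => φ.symm (q + s • d)) (M d) t := hM.comp_hasDerivAt t h1
      have h3 : HasDerivAt (fun s : ℝ => Λ (φ.symm (q + s • d)))
          (fderiv ℝ Λ (φ.symm (q + t • d)) (M d)) t :=
        hx.2.2.1.hasFDerivAt.comp_hasDerivAt t h2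
      have h4 : fderiv ℝ Λ (φ.symm (q + t • d)) (M d) = 0 := by
        rw [hc, _root_.smul_apply, hMw, hd, smul_zero]
      rwa [h4] at h3
    have h := constant_of_has_deriv_right_zero (f := fun s : ℝ => Λ (φ.symm (q + s • d))) (a := 0) (b := 1)
      (fun t ht => (hG t ht).continuousAt.continuousWithinAt)
      (fun t ht => (hG t (Ico_subset_Icc_self ht)).hasDerivWithinAt) 1 (right_mem_Icc.2 zero_le_one)
    simpa [hd_def] using h
  -- conclusion
  refine ⟨fun s => Λ (φ.symm (Φ y + (s - w y) • e)), ?_⟩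
  have h1 : ∀ᶠ x in 𝓝 y, Φ x ∈ ball (Φ y) r := hΦy.continuousAt.preimage_mem_nhds (ball_mem_nhds _ hr)
  have h2 : ∀ᶠ x in 𝓝 y, Φ y + (w x - w y) • e ∈ ball (Φ y) r := by
    have hc : ContinuousAt (fun x => Φ y + (w x - w y) • e) y :=
      continuousAt_const.add ((hw.continuousAt.sub continuousAt_const).smul continuousAt_const)
    have h0 : Φ y + (w y - w y) • e = Φ y := by simp
    refine hc.preimage_mem_nhds ?_
    rw [h0]
    exact ball_mem_nhds _ hr
  have h3 : ∀ᶠ x in 𝓝 y, x ∈ φ.source := φ.open_source.mem_nhds hyS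
  filter_upwards [h1, h2, h3] with x hx1 hx2 hx3
  have hℓeq : ℓ (Φ x) = ℓ (Φ y + (w x - w y) • e) := by
    rw [hΦw, map_add, hΦw, map_smul, hℓ, smul_eq_mul, mul_one]
    ring
  have h := hconst _ _ hx1 hx2 hℓeq
  have hxΦ : φ.symm (Φ x) = x := by rw [← hφ]; exact φ.left_inv hx3
  rw [hxΦ] at h
  exact h.symm

/-- **Rank-one functional dependence, minors form.**  As `exists_comp_eq_of_fderiv_eq_smul`, with the parallelism hypothesis
written as the vanishing of all `2 × 2` minors of `(DΛ, Dw)` near `y` (the form produced by L0(a)). [folklore] -/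
theorem exists_comp_eq_of_minors_eq_zero [CompleteSpace E] {Λ w : E → ℝ} {y e : E}
    (hw : ContDiffAt ℝ 1 w y) (he : fderiv ℝ w y e ≠ 0)
    (hΛ : ∀ᶠ x in 𝓝 y, DifferentiableAt ℝ Λ x)
    (hminor : ∀ᶠ x in 𝓝 y, ∀ u v : E,
      fderiv ℝ Λ x u * fderiv ℝ w x v - fderiv ℝ Λ x v * fderiv ℝ w x u = 0) :
    ∃ g : ℝ → ℝ, ∀ᶠ x in 𝓝 y, Λ x = g (w x) := by
  have hne : ∀ᶠ x in 𝓝 y, fderiv ℝ w x e ≠ 0 :=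
    (((ContinuousLinearMap.apply ℝ ℝ e).continuous.continuousAt).comp
      (hw.continuousAt_fderiv one_ne_zero)).eventually_ne he
  refine exists_comp_eq_of_fderiv_eq_smul hw he hΛ ?_
  filter_upwards [hne, hminor] with x hx hm
  exact ⟨_, eq_smul_of_minors_eq_zero hx hm⟩

/-- **Quotient form (the slope `Λ = N/D`).**  Let `w` be `C¹` at `y`; let `N, D : E → ℝ` be differentiable near `y` with
`D = Dw(·) e` near `y` and `D y ≠ 0`; suppose the minors of `(D·∇N − N·∇D, ∇w)` vanish near `y` (the cleared-denominator form of
«`∇(N/D) ∥ ∇w`», as output by L0(a)).  Then `N = g(w)·D` near `y` for some `g : ℝ → ℝ`. [folklore] -/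
theorem exists_slope_function_near [CompleteSpace E] {N D w : E → ℝ} {y e : E}
    (hw : ContDiffAt ℝ 1 w y)
    (hN : ∀ᶠ x in 𝓝 y, DifferentiableAt ℝ N x) (hD : ∀ᶠ x in 𝓝 y, DifferentiableAt ℝ D x)
    (hDw : ∀ᶠ x in 𝓝 y, D x = fderiv ℝ w x e) (hDy : D y ≠ 0)
    (hminor : ∀ᶠ x in 𝓝 y, ∀ u v : E,
      (D x * fderiv ℝ N x u - N x * fderiv ℝ D x u) * fderiv ℝ w x v -
        (D x * fderiv ℝ N x v - N x * fderiv ℝ D x v) * fderiv ℝ w x u = 0) :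
    ∃ g : ℝ → ℝ, ∀ᶠ x in 𝓝 y, N x = g (w x) * D x := by
  have hDne : ∀ᶠ x in 𝓝 y, D x ≠ 0 := hD.self_of_nhds.continuousAt.eventually_ne hDy
  have he : fderiv ℝ w y e ≠ 0 := by rw [← hDw.self_of_nhds]; exact hDy
  -- the slope and its differentiability
  set Λ : E → ℝ := fun x => N x * (D x)⁻¹ with hΛdef
  -- an open set `V ∋ y` on which everything holds
  obtain ⟨V, hVsub, hVopen, hyV⟩ := _root_.mem_nhds_iff.1 (hN.and (hD.and (hDne.and (hminor.and hDw))))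
  have hΛV : ∀ x ∈ V, HasFDerivAt Λ
      (N x • ((ContinuousLinearMap.toSpanSingleton ℝ (-(D x ^ 2)⁻¹)).comp (fderiv ℝ D x)) +
        (D x)⁻¹ • fderiv ℝ N x) x := by
    intro x hx
    have h := hVsub hx
    have hinv : HasFDerivAt (fun z => (D z)⁻¹)
        ((ContinuousLinearMap.toSpanSingleton ℝ (-(D x ^ 2)⁻¹)).comp (fderiv ℝ D x)) x :=
      (hasFDerivAt_inv h.2.2.1).comp x h.2.1.hasFDerivAt
    exact h.1.hasFDerivAt.mul hinv
  have hΛ : ∀ᶠ x in 𝓝 y, DifferentiableAt ℝ Λ x := by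
    filter_upwards [hVopen.mem_nhds hyV] with x hx
    exact (hΛV x hx).differentiableAt
  -- `D² ∇Λ = D ∇N − N ∇D`, so the minors of `(∇Λ, ∇w)` vanish on `V`
  have hΛmin : ∀ᶠ x in 𝓝 y, ∀ u v : E,
      fderiv ℝ Λ x u * fderiv ℝ w x v - fderiv ℝ Λ x v * fderiv ℝ w x u = 0 := by
    filter_upwards [hVopen.mem_nhds hyV] with x hx
    have h := hVsub hx
    have hDx : D x ≠ 0 := h.2.2.1
    have hfd : ∀ u, D x ^ 2 * fderiv ℝ Λ x u = D x * fderiv ℝ N x u - N x * fderiv ℝ D x u := by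
      intro u
      rw [(hΛV x hx).fderiv]
      simp only [_root_.add_apply, _root_.smul_apply, smul_eq_mul, ContinuousLinearMap.comp_apply,
        ContinuousLinearMap.toSpanSingleton_apply]
      field_simp
      ring
    intro u v
    have hm := h.2.2.2.1 u v
    have hD2 : D x ^ 2 ≠ 0 := pow_ne_zero 2 hDx
    have key : D x ^ 2 * (fderiv ℝ Λ x u * fderiv ℝ w x v - fderiv ℝ Λ x v * fderiv ℝ w x u) = 0 := by
      have : D x ^ 2 * (fderiv ℝ Λ x u * fderiv ℝ w x v - fderiv ℝ Λ x v * fderiv ℝ w x u) =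
          (D x ^ 2 * fderiv ℝ Λ x u) * fderiv ℝ w x v - (D x ^ 2 * fderiv ℝ Λ x v) * fderiv ℝ w x u := by ring
      rw [this, hfd u, hfd v]
      exact hm
    rcases mul_eq_zero.1 key with h0 | h0
    · exact absurd h0 hD2
    · exact h0
  obtain ⟨g, hg⟩ := exists_comp_eq_of_minors_eq_zero hw he hΛ hΛmin
  refine ⟨g, ?_⟩
  filter_upwards [hg, hDne] with x hx hDx
  rw [← hx, hΛdef]
  simp only
  rw [inv_mul_cancel_right₀ hDx]

/-- **L0(b), local form, for an analytic slice (compose with L0(a) `…ZShockAutonomyGlobal.minors_eq_zero_of_local_slope_function`).**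
Let `f : ℝ³ → ℝ³` be real-analytic and `b : Fin 3`.  If the minors of `(∂_b f₂·∇(∂_z f_b) − ∂_z f_b·∇(∂_b f₂), ∇f₂)` vanish at
every point (`∂_z = D(·)(e₂)`, `∂_b = D(·)(e_b)`), then near every point `x` with `∂_b f₂(x) ≠ 0` the vertical shear of `f_b` is a
slope FUNCTION of the height component: `∂_z f_b = g(f₂)·∂_b f₂` on an open `U ∋ x`, for some `g : ℝ → ℝ` (depending on `x`).
[folklore] -/
theorem exists_slope_function_near_of_analytic {f : EuclideanSpace ℝ (Fin 3) → EuclideanSpace ℝ (Fin 3)}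
    (hf : AnalyticOnNhd ℝ f univ) {b : Fin 3}
    (hminor : ∀ x u u' : EuclideanSpace ℝ (Fin 3),
      (fderiv ℝ f x (EuclideanSpace.single b 1) 2 *
            fderiv ℝ (fun y => fderiv ℝ f y (EuclideanSpace.single 2 1) b) x u -
          fderiv ℝ f x (EuclideanSpace.single 2 1) b *
            fderiv ℝ (fun y => fderiv ℝ f y (EuclideanSpace.single b 1) 2) x u) *
          fderiv ℝ (fun y => f y 2) x u' -
        (fderiv ℝ f x (EuclideanSpace.single b 1) 2 *
            fderiv ℝ (fun y => fderiv ℝ f y (EuclideanSpace.single 2 1) b) x u' -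
          fderiv ℝ f x (EuclideanSpace.single 2 1) b *
            fderiv ℝ (fun y => fderiv ℝ f y (EuclideanSpace.single b 1) 2) x u') *
          fderiv ℝ (fun y => f y 2) x u = 0)
    {x : EuclideanSpace ℝ (Fin 3)} (hx : fderiv ℝ f x (EuclideanSpace.single b 1) 2 ≠ 0) :
    ∃ g : ℝ → ℝ, ∃ U : Set (EuclideanSpace ℝ (Fin 3)), IsOpen U ∧ x ∈ U ∧
      ∀ x' ∈ U, fderiv ℝ f x' (EuclideanSpace.single 2 1) b =
        g (f x' 2) * fderiv ℝ f x' (EuclideanSpace.single b 1) 2 := by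
  set N : EuclideanSpace ℝ (Fin 3) → ℝ := fun y => fderiv ℝ f y (EuclideanSpace.single 2 1) b with hNdef
  set D : EuclideanSpace ℝ (Fin 3) → ℝ := fun y => fderiv ℝ f y (EuclideanSpace.single b 1) 2 with hDdef
  set w : EuclideanSpace ℝ (Fin 3) → ℝ := fun y => f y 2 with hwdef
  have hN : AnalyticOnNhd ℝ N univ := analyticOnNhd_fderiv_apply_coord hf _ _
  have hD : AnalyticOnNhd ℝ D univ := analyticOnNhd_fderiv_apply_coord hf _ _
  have hw : AnalyticOnNhd ℝ w univ := analyticOnNhd_coord hf 2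
  have hw1 : ContDiffAt ℝ 1 w x := (hw x (mem_univ _)).contDiffAt
  have hDw : ∀ y, D y = fderiv ℝ w y (EuclideanSpace.single b 1) := by
    intro y
    simp only [hwdef, hDdef, fderiv_coord_apply (hf y (mem_univ _)).differentiableAt]
  obtain ⟨g, hg⟩ := exists_slope_function_near (N := N) (D := D) (e := EuclideanSpace.single b 1) hw1
    (Eventually.of_forall fun y => (hN y (mem_univ _)).differentiableAt)
    (Eventually.of_forall fun y => (hD y (mem_univ _)).differentiableAt)
    (Eventually.of_forall hDw) hx (Eventually.of_forall fun y u v => hminor y u v)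
  obtain ⟨U, hUsub, hUopen, hxU⟩ := _root_.mem_nhds_iff.1 hg
  exact ⟨g, U, hUopen, hxU, fun x' hx' => hUsub hx'⟩

/-- **L0(a) + L0(b)-local for the route's class: the local autonomy clause propagates along the slice.**  Let `v` have the Type-I
time rate, be continuous on the open backward slab and satisfy the unit-viscosity Oseen identity between negative times (class
binders of `stub_zShockThickAut`).  If the stub's LOCAL autonomy clause holds at a point `z₀` of an open `W₁` inside the slab —
`∂_z v_b = g(t, v₂)·∂_b v₂` on `W₁` for `b ≠ 2` — then at EVERY point `x` of the slice `t₀ = z₀.1` with `∂_b v₂(t₀, x) ≠ 0` there are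
an open `U ∋ x` and a slope function `g_x : ℝ → ℝ` with `∂_z v_b = g_x(v₂)·∂_b v₂` on `U` (slice analyticity, tree
`…Ancient.analyticOnNhd_slice`, through `minors_eq_zero_of_class_autonomy`).  Patching the `g_x` across the slice (L0(c)) is NOT
addressed. [folklore] -/
theorem local_slope_function_of_class_autonomy (C : ℝ) (v : ℝ → EuclideanSpace ℝ (Fin 3) → EuclideanSpace ℝ (Fin 3))
    (hrate : Literature.Analysis.FluidPDE.HasTypeITimeDecay C v)
    (hcont : ContinuousOn (Function.uncurry v) (Set.Iio (0 : ℝ) ×ˢ Set.univ))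
    (hmild : ∀ s t : ℝ, s < t → t < 0 → ∀ x, v t x =
      Literature.Analysis.UnboundedOperators.heatExtension (v s) (t - s) x -
        Literature.Analysis.FluidPDE.oseenDuhamel 1 s v v t x)
    {W₁ : Set (ℝ × EuclideanSpace ℝ (Fin 3))} (hW₁ : IsOpen W₁) (hW₁s : W₁ ⊆ Set.Iio (0 : ℝ) ×ˢ Set.univ)
    {z₀ : ℝ × EuclideanSpace ℝ (Fin 3)} (hz₀ : z₀ ∈ W₁) {g : ℝ → ℝ → ℝ}
    (haut : ∀ z ∈ W₁, ∀ b : Fin 3, b ≠ 2 →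
      fderiv ℝ (v z.1) z.2 (EuclideanSpace.single 2 1) b =
        g z.1 (v z.1 z.2 2) * fderiv ℝ (v z.1) z.2 (EuclideanSpace.single b 1) 2)
    {b : Fin 3} (hb : b ≠ 2) {x : EuclideanSpace ℝ (Fin 3)}
    (hx : fderiv ℝ (v z₀.1) x (EuclideanSpace.single b 1) 2 ≠ 0) :
    ∃ gx : ℝ → ℝ, ∃ U : Set (EuclideanSpace ℝ (Fin 3)), IsOpen U ∧ x ∈ U ∧
      ∀ x' ∈ U, fderiv ℝ (v z₀.1) x' (EuclideanSpace.single 2 1) b =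
        gx (v z₀.1 x' 2) * fderiv ℝ (v z₀.1) x' (EuclideanSpace.single b 1) 2 := by
  -- slice analyticity (as in `minors_eq_zero_of_class_autonomy`)
  have ht₀ : z₀.1 < 0 := (Set.mem_prod.1 (hW₁s hz₀)).1
  have hbdd : ∀ δ : ℝ, 0 < δ → ∃ B : ℝ, ∀ t < -δ, ∀ y : EuclideanSpace ℝ (Fin 3), ‖v t y‖ ≤ B := by
    intro δ hδ
    refine ⟨|C| / Real.sqrt δ, fun t ht y => ?_⟩
    have hδt : δ ≤ -t := by linarith
    have hsq : Real.sqrt δ ≤ Real.sqrt (-t) := Real.sqrt_le_sqrt hδt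
    have hsqpos : 0 < Real.sqrt δ := Real.sqrt_pos.2 hδ
    calc ‖v t y‖ ≤ C / Real.sqrt (-t) := hrate t (by linarith) y
      _ ≤ |C| / Real.sqrt (-t) := by gcongr; exact le_abs_self C
      _ ≤ |C| / Real.sqrt δ := by gcongr
  have han : AnalyticOnNhd ℝ (v z₀.1) univ :=
    Literature.Analysis.NavierStokesZoomKit.LocalSineTubeDoorProfileAlignedWindowRigidityAncient.analyticOnNhd_slice
      hcont hbdd hmild ht₀
  exact exists_slope_function_near_of_analytic han
    (fun y u u' => minors_eq_zero_of_class_autonomy C v hrate hcont hmild hW₁ hW₁s hz₀ haut hb y u u') hx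

end Summit.NavierStokesRegularity.NavierStokesRegularity.Theorems.PoloidalWindowDoorPoloidalWindowRigidityZShockSlopeFunctionLocal

end
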